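import Summits.AtomisticToContinuum.FouriersLaw.Theorems.OddSectorIrreversibilityTapLeakBoundFloorWindow
import Summits.AtomisticToContinuum.FouriersLaw.Theorems.OddSectorIrreversibilityTapLeakBoundFloorBudgetTail

/-!
# `TapLeakBound` (stmt-AtomisticToContinuum-15159), line `SketchIdeator2`, floor of `stub_kickCone`: per-site tails and three small lemmas

Helper file (`--supports stmt-AtomisticToContinuum-15159`) for crux
P = `Summit.AtomisticToContinuum.FouriersLaw.Theses.OddSectorIrreversibility.TapLeakBound`, registered stub `stub_kickCone`
(C′ `ResampledKickCone`), FLOOR program (lead c3: the `N`-uniform resampled-kick cone of the CLOSED chain in the sublinear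
window `s⁴ ≤ a(1+d)³`). Preliminaries of the core assembly (`…FloorCore.lean`):

* `budget_tail_le` (registered sub-goal `stub_floorTail`) — the per-site tail of the energy budget at cap `E`:
  `μ_T{E < X + ∫_{(0,s]}(|f|+|g|)∘Φ} ≤ ((2/E)⁷ C₇ + (4s/E)²⁸ C₂₈) Z` (the landed higher-moment maximal inequality
  `stub_floorBudgetTail` with `m = 7`, `k = 28`, fed with moment bounds);
* `card_block_le` — the block has at most `3(1+d)` sites;
* `sq_le_of_abs_le_mul` — squaring the good-event bound; `half_sq_snd_le_hamiltonian` — `p_b²/2 ≤ H`;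
* `integral_prod_sq_sub` — the kick's second moment on the product `μ_T ⊗ N(0,T)`: `∫∫ (p_b − p')² = ∫ p_b² dμ_T + T μ_T(univ)`.

References: folklore. Nothing here closes the item.
-/

noncomputable section

open MeasureTheory ProbabilityTheory Filter Topology Set Function
open scoped NNReal ENNReal

namespace Summit.AtomisticToContinuum.FouriersLaw.Theorems.OddSectorIrreversibility.TapLeak

open Literature.MathematicalPhysics.KineticTheory.HeatConduction
open Literature.MathematicalPhysics.KineticTheory
open Summit.AtomisticToContinuum.FouriersLaw.Theorems.OddSectorWitness
open Summit.AtomisticToContinuum.FouriersLaw.Theorems.ClosedConeSensitivity.Negative.ZeroFrictionDictionary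
open Summit.AtomisticToContinuum.FouriersLaw.Theorems.OddSectorIrreversibility.Corrector

/-! ### The per-site tail at the cap, and the block sum -/

section Tail

variable {ω₂ lam β : ℝ} (hω : 0 < ω₂) (hl : 0 ≤ lam) (hβ : 0 ≤ β) (γ : ℝ) {T : ℝ} (hT : 0 < T)
include hω hl hβ hT

/-- **Per-site tail of the budget** (the registered `stub_floorBudgetTail` with `m = 7`, `k = 28`, fed with moment bounds):
for a site `m` with site energy `X` (`0 ≤ X`, continuous, `∫ X⁷ ≤ C₇ Z`), left/right currents `f, g` (continuous,
`∫ |f|²⁸, ∫ |g|²⁸ ≤ C₂₈ Z`), `s ≥ 0`, `E > 0`: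
`μ_T{E < X + ∫_{(0,s]}(|f|+|g|)∘Φ} ≤ ((2/E)⁷ C₇ + (4s/E)²⁸ C₂₈) Z`. [folklore] -/
theorem budget_tail_le {N : ℕ} {X f g : PhaseSpace N → ℝ} (hX0 : ∀ x, 0 ≤ X x) (hXc : Continuous X)
    (hf : Continuous f) (hg : Continuous g) {C₇ C₂₈ : ℝ}
    (hX7 : Integrable (fun x => X x ^ 7) (gibbsWeight ω₂ lam β γ N T) ∧
      ∫ x, X x ^ 7 ∂(gibbsWeight ω₂ lam β γ N T) ≤
        C₇ * ∫ x, Real.exp (-((pinnedChain ω₂ lam β γ).hamiltonian N x) / T) ∂volume)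
    (hf28 : Integrable (fun x => |f x| ^ 28) (gibbsWeight ω₂ lam β γ N T) ∧
      ∫ x, |f x| ^ 28 ∂(gibbsWeight ω₂ lam β γ N T) ≤
        C₂₈ * ∫ x, Real.exp (-((pinnedChain ω₂ lam β γ).hamiltonian N x) / T) ∂volume)
    (hg28 : Integrable (fun x => |g x| ^ 28) (gibbsWeight ω₂ lam β γ N T) ∧
      ∫ x, |g x| ^ 28 ∂(gibbsWeight ω₂ lam β γ N T) ≤
        C₂₈ * ∫ x, Real.exp (-((pinnedChain ω₂ lam β γ).hamiltonian N x) / T) ∂volume)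
    {s E : ℝ} (hs : 0 ≤ s) (hE : 0 < E) :
    (gibbsWeight ω₂ lam β γ N T).real {x | E < X x +
        ∫ t in Ioc (0 : ℝ) s, (|f (detFlow ω₂ lam β N t x)| + |g (detFlow ω₂ lam β N t x)|)} ≤
      ((2 / E) ^ 7 * C₇ + (4 * s / E) ^ 28 * C₂₈) *
        ∫ x, Real.exp (-((pinnedChain ω₂ lam β γ).hamiltonian N x) / T) ∂volume := by
  set Z := ∫ x, Real.exp (-((pinnedChain ω₂ lam β γ).hamiltonian N x) / T) ∂volume with hZ
  have h := stub_floorBudgetTail ω₂ lam β hω hl hβ γ N T hT X f g 7 28 (by norm_num) (by norm_num) hX0 hXc hf hg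
    hX7.1 hf28.1 hg28.1 s E hs hE
  have h1 : (2 / E) ^ 7 * ∫ x, X x ^ 7 ∂(gibbsWeight ω₂ lam β γ N T) ≤ (2 / E) ^ 7 * (C₇ * Z) :=
    mul_le_mul_of_nonneg_left hX7.2 (by positivity)
  have h2 : (4 * s / E) ^ 28 / 2 * ((∫ x, |f x| ^ 28 ∂(gibbsWeight ω₂ lam β γ N T)) +
      ∫ x, |g x| ^ 28 ∂(gibbsWeight ω₂ lam β γ N T)) ≤ (4 * s / E) ^ 28 / 2 * (C₂₈ * Z + C₂₈ * Z) :=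
    mul_le_mul_of_nonneg_left (add_le_add hf28.2 hg28.2) (by positivity)
  calc _ ≤ _ := h
    _ ≤ (2 / E) ^ 7 * (C₇ * Z) + (4 * s / E) ^ 28 / 2 * (C₂₈ * Z + C₂₈ * Z) := add_le_add h1 h2
    _ = ((2 / E) ^ 7 * C₇ + (4 * s / E) ^ 28 * C₂₈) * Z := by ring

omit hω hl hβ hT in
/-- The block has at most `2d + 3 ≤ 3(1 + d)` sites. [folklore] -/
theorem card_block_le (N d : ℕ) :
    ((Finset.univ.filter fun m : Fin N => m.val ≤ 2 * d + 2).card : ℝ) ≤ 3 * (1 + (d : ℝ)) := by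
  have h : (Finset.univ.filter fun m : Fin N => m.val ≤ 2 * d + 2).card ≤ 2 * d + 3 := by
    calc (Finset.univ.filter fun m : Fin N => m.val ≤ 2 * d + 2).card
        ≤ (Finset.range (2 * d + 3)).card := by
          refine Finset.card_le_card_of_injOn (fun m : Fin N => m.val) ?_ ?_
          · intro m hm
            simp only [Finset.coe_filter, Finset.mem_univ, true_and, Set.mem_setOf_eq] at hm
            simp only [Finset.coe_range, Set.mem_Iio]
            omega
          · intro m _ m' _ hmm'
            exact Fin.ext hmm'
      _ = 2 * d + 3 := Finset.card_range _
  have h' : ((Finset.univ.filter fun m : Fin N => m.val ≤ 2 * d + 2).card : ℝ) ≤ (2 * d + 3 : ℕ) := by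
    exact_mod_cast h
  refine h'.trans ?_
  push_cast
  have : (0 : ℝ) ≤ d := Nat.cast_nonneg d
  linarith

end Tail
/-! ### Three small lemmas for the core assembly -/

section Core

variable {ω₂ lam β : ℝ} (hω : 0 < ω₂) (hl : 0 < lam) (hβ : 0 ≤ β) (γ : ℝ) {T : ℝ} (hT : 0 < T)
include hω hl hβ hT

omit hω hl hβ hT in
/-- Squaring the good-event bound: `|Δ| ≤ K (u + c) θ` gives `Δ² ≤ 2K²(u² + c²)θ²`. [folklore] -/
theorem sq_le_of_abs_le_mul {Δ K u c θ : ℝ} (h : |Δ| ≤ K * (u + c) * θ) : Δ ^ 2 ≤ 2 * K ^ 2 * (u ^ 2 + c ^ 2) * θ ^ 2 := by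
  have h0 : 0 ≤ K * (u + c) * θ := (abs_nonneg _).trans h
  have h1 : Δ ^ 2 ≤ (K * (u + c) * θ) ^ 2 := by
    rw [← sq_abs Δ]; exact pow_le_pow_left₀ (abs_nonneg _) h 2
  have h2 : (u + c) ^ 2 ≤ 2 * (u ^ 2 + c ^ 2) := by nlinarith [sq_nonneg (u - c)]
  calc Δ ^ 2 ≤ (K * (u + c) * θ) ^ 2 := h1
    _ = K ^ 2 * (u + c) ^ 2 * θ ^ 2 := by ring
    _ ≤ K ^ 2 * (2 * (u ^ 2 + c ^ 2)) * θ ^ 2 := by gcongr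
    _ = _ := by ring

omit hl hT in
/-- A single kinetic term is below the energy: `p_b²/2 ≤ H` (pinned chain, `lam, β ≥ 0`). [folklore] -/
theorem half_sq_snd_le_hamiltonian (hl' : 0 ≤ lam) {N : ℕ} (b : Fin N) (x : PhaseSpace N) :
    (x.2 b) ^ 2 / 2 ≤ (pinnedChain ω₂ lam β γ).hamiltonian N x := by
  have h := pinnedChain_harmonic_le_hamiltonian (ω₂ := ω₂) hl' hβ γ N x
  have h1 : (x.2 b) ^ 2 / 2 ≤ ∑ k, x.2 k ^ 2 / 2 :=
    Finset.single_le_sum (f := fun k => x.2 k ^ 2 / 2) (fun k _ => by positivity) (Finset.mem_univ b)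
  have h2 : 0 ≤ ∑ i, ω₂ * x.1 i ^ 2 / 2 := Finset.sum_nonneg fun i _ => by positivity
  linarith

omit hl in
/-- The kick's squared size integrates on the product: `∫∫ (p_b - p')² d(μ_T ⊗ N(0,T)) = ∫ p_b² dμ_T + T · μ_T(univ)`. [folklore] -/
theorem integral_prod_sq_sub (hl' : 0 ≤ lam) {N : ℕ} (b : Fin N) :
    Integrable (fun z : PhaseSpace N × ℝ => (z.1.2 b - z.2) ^ 2)
        ((gibbsWeight ω₂ lam β γ N T).prod (gaussianReal 0 (Real.toNNReal T))) ∧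
      ∫ z, (z.1.2 b - z.2) ^ 2 ∂((gibbsWeight ω₂ lam β γ N T).prod (gaussianReal 0 (Real.toNNReal T))) =
        (∫ x, (x.2 b) ^ 2 ∂(gibbsWeight ω₂ lam β γ N T)) + T * (gibbsWeight ω₂ lam β γ N T).real univ := by
  set μ := gibbsWeight ω₂ lam β γ N T with hμ
  set ν : Measure ℝ := gaussianReal 0 (Real.toNNReal T) with hν
  haveI : IsFiniteMeasure μ := isFiniteMeasure_gibbsWeight hω hl' hβ γ N hT
  haveI : IsProbabilityMeasure ν := by rw [hν]; infer_instance
  have hp2 : Integrable (fun x : PhaseSpace N => (x.2 b) ^ 2) μ := by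
    refine integrable_of_abs_le_pow hω hl' hβ γ N hT (by fun_prop) 2 1 fun x => ?_
    have hH := pinnedChain_hamiltonian_nonneg hω.le hl' hβ γ N x
    have hpx : (x.2 b) ^ 2 / 2 ≤ (pinnedChain ω₂ lam β γ).hamiltonian N x := half_sq_snd_le_hamiltonian hω hβ γ hl' b x
    rw [abs_of_nonneg (sq_nonneg _)]
    linarith
  have hmeas : AEStronglyMeasurable (fun z : PhaseSpace N × ℝ => (z.1.2 b - z.2) ^ 2) (μ.prod ν) := by
    fun_prop
  have hinner : ∀ x : PhaseSpace N, ∫ p', (x.2 b - p') ^ 2 ∂ν = (x.2 b) ^ 2 + T := fun x =>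
    integral_sq_sub_gaussianReal hT (x.2 b)
  have hint : Integrable (fun z : PhaseSpace N × ℝ => (z.1.2 b - z.2) ^ 2) (μ.prod ν) := by
    rw [integrable_prod_iff hmeas]
    refine ⟨Eventually.of_forall fun x => integrable_sq_sub_gaussianReal T (x.2 b), ?_⟩
    have e : (fun x : PhaseSpace N => ∫ p', ‖(x.2 b - p') ^ 2‖ ∂ν) = fun x => (x.2 b) ^ 2 + T := by
      funext x
      rw [← hinner x]
      exact integral_congr_ae (Eventually.of_forall fun p' => by simp [Real.norm_of_nonneg (sq_nonneg _)])
    rw [e]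
    exact hp2.add (integrable_const T)
  refine ⟨hint, ?_⟩
  rw [integral_prod _ hint]
  simp_rw [hinner]
  rw [integral_add hp2 (integrable_const T), integral_const, smul_eq_mul, mul_comm]

end Core

/-! ### Registered sub-goal of the line (closed form of `budget_tail_le`) -/

/-- **Sub-goal `stub_floorTail`** (registered on the crux item for this helper file; closed `∀`-form of `budget_tail_le`):
the per-site tail of the energy budget at the cap. [folklore] -/
theorem stub_floorTail : ∀ (ω₂ lam β : ℝ), 0 < ω₂ → 0 ≤ lam → 0 ≤ β → ∀ (γ : ℝ) (N : ℕ) (T : ℝ), 0 < T → ∀ (X f g : PhaseSpace N → ℝ), (∀ x, 0 ≤ X x) → Continuous X → Continuous f → Continuous g → ∀ (C₇ C₂₈ : ℝ), (MeasureTheory.Integrable (fun x => X x ^ 7) (gibbsWeight ω₂ lam β γ N T) ∧ ∫ x, X x ^ 7 ∂(gibbsWeight ω₂ lam β γ N T) ≤ C₇ * ∫ x, Real.exp (-((pinnedChain ω₂ lam β γ).hamiltonian N x) / T) ∂MeasureTheory.volume) → (MeasureTheory.Integrable (fun x => |f x| ^ 28) (gibbsWeight ω₂ lam β γ N T) ∧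 ∫ x, |f x| ^ 28 ∂(gibbsWeight ω₂ lam β γ N T) ≤ C₂₈ * ∫ x, Real.exp (-((pinnedChain ω₂ lam β γ).hamiltonian N x) / T) ∂MeasureTheory.volume) → (MeasureTheory.Integrable (fun x => |g x| ^ 28) (gibbsWeight ω₂ lam β γ N T) ∧ ∫ x, |g x| ^ 28 ∂(gibbsWeight ω₂ lam β γ N T) ≤ C₂₈ * ∫ x, Real.exp (-((pinnedChain ω₂ lam β γ).hamiltonian N x) / T) ∂MeasureTheory.volume) → ∀ (s E : ℝ), 0 ≤ s → 0 < E → (gibbsWeight ω₂ lam β γ N T).real {x | E < X x + ∫ t in Set.Ioc (0 : ℝ) s, (|f (Summit.AtomisticToContinuum.FouriersLaw.Theorems.ClosedConeSensitivity.Negative.ZeroFrictionDictionary.detFlow ω₂ lam β N t x)| + |g (Summit.AtomisticToContinuum.FouriersLaw.Theorems.ClosedConeSensitivity.Negative.ZeroFrictionDictionary.detFlow ω₂ lam β N t x)|)} ≤ ((2 / E) ^ 7 * C₇ + (4 * s / E) ^ 28 * C₂₈) * ∫ x, Real.exp (-((pinnedChain ω₂ lam β γ).hamiltonian N x) / T)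 ∂MeasureTheory.volume :=
  fun _ _ _ hω hl hβ γ _ _ hT _ _ _ hX0 hXc hf hg _ _ hX7 hf28 hg28 _ _ hs hE =>
    budget_tail_le hω hl hβ γ hT hX0 hXc hf hg hX7 hf28 hg28 hs hE

end Summit.AtomisticToContinuum.FouriersLaw.Theorems.OddSectorIrreversibility.TapLeak

end
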